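import Literature.Computability.AlgebraicComplexity.BurgisserBooleanPartsA3Assembly

/-!
# LangWeilTransfer, support item `TameResolution` (stmt-ValiantsHypothesis-6378) — weight and
# total degree of determinants of polynomial matrices

Route `LangWeilTransfer` of `ValiantsHypothesis` (conditional route; honest framing: bookkeeping,
nothing here bears on VP ≠ VNP). Tools of the QUANTITATIVE pass (roadmap note of val-lit-p6 g9,
§1(B): the resultant `Res_U(q, q')` and the Bézout cofactor `B` are (signed minors of) Sylvester
determinants):

* `weight_det_le` — `wt(det M) ≤ |ι|! · W^{|ι|}` if all entries have weight `≤ W`;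
* `totalDegree_det_le` — `deg(det M) ≤ |ι| · D` if all entries have total degree `≤ D`;
* `weight_updateRow_single_le`, `totalDegree_updateRow_single_le` — the same hypotheses survive
  replacing a row by a standard basis vector (adjugate entries, `Matrix.adjugate_apply`).
-/

noncomputable section

open MvPolynomial
open Literature.Computability.AlgebraicComplexity

-- the summit and the problem share the name `ValiantsHypothesis` (D-0017 single-conjunct layout)
set_option linter.dupNamespace false

namespace Summit.ValiantsHypothesis.ValiantsHypothesis.Theorems.LangWeilTransfer

variable {ι κ : Type*} [Fintype ι] [DecidableEq ι]

/-- The weight is invariant under the sign action of a unit of `ℤ`. -/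
theorem weight_units_smul (ε : ℤˣ) (f : MvPolynomial κ ℤ) : weight (ε • f) = weight f := by
  rcases Int.units_eq_one_or ε with rfl | rfl
  · rw [one_smul]
  · rw [Units.smul_def, Units.val_neg, Units.val_one, neg_one_smul, weight_neg]

/-- **Weight of a determinant.** If every entry of `M` has weight `≤ W`, then
`wt(det M) ≤ |ι|! · W^{|ι|}`. -/
theorem weight_det_le (M : Matrix ι ι (MvPolynomial κ ℤ)) {W : ℕ} (hM : ∀ i j, weight (M i j) ≤ W) :
    weight M.det ≤ (Fintype.card ι).factorial * W ^ Fintype.card ι := by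
  rw [Matrix.det_apply]
  refine (weight_finset_sum_le _ _).trans ?_
  calc ∑ σ : Equiv.Perm ι, weight (Equiv.Perm.sign σ • ∏ i, M (σ i) i)
      ≤ ∑ _σ : Equiv.Perm ι, W ^ Fintype.card ι := by
        refine Finset.sum_le_sum fun σ _ => ?_
        rw [weight_units_smul]
        refine (weight_finset_prod_le _ _).trans ?_
        calc ∏ i, weight (M (σ i) i) ≤ ∏ _i : ι, W :=
              Finset.prod_le_prod (fun _ _ => Nat.zero_le _) fun i _ => hM _ _
          _ = W ^ Fintype.card ι := by rw [Finset.prod_const, Finset.card_univ]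
    _ = (Fintype.card ι).factorial * W ^ Fintype.card ι := by
        rw [Finset.sum_const, Finset.card_univ, Fintype.card_perm, smul_eq_mul]

/-- **Total degree of a determinant.** If every entry of `M` has total degree `≤ D`, then
`deg(det M) ≤ |ι| · D`. -/
theorem totalDegree_det_le {R : Type*} [CommRing R] (M : Matrix ι ι (MvPolynomial κ R)) {D : ℕ}
    (hM : ∀ i j, (M i j).totalDegree ≤ D) : M.det.totalDegree ≤ Fintype.card ι * D := by
  rw [Matrix.det_apply]
  refine totalDegree_finsetSum_le fun σ _ => ?_
  rw [Units.smul_def]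
  refine (totalDegree_smul_le _ _).trans ?_
  refine (totalDegree_finsetProd _ _).trans ?_
  calc ∑ i, (M (σ i) i).totalDegree ≤ ∑ _i : ι, D := Finset.sum_le_sum fun i _ => hM _ _
    _ = Fintype.card ι * D := by rw [Finset.sum_const, Finset.card_univ, smul_eq_mul]

omit [Fintype ι] in
/-- Entries of weight `≤ W` (`1 ≤ W`) stay so after replacing a row by a standard basis vector. -/
theorem weight_updateRow_single_le (M : Matrix ι ι (MvPolynomial κ ℤ)) {W : ℕ} (hW : 1 ≤ W)
    (hM : ∀ i j, weight (M i j) ≤ W) (j₀ i₀ i j : ι) :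
    weight (M.updateRow j₀ (Pi.single i₀ 1) i j) ≤ W := by
  rw [Matrix.updateRow_apply]
  split_ifs with h
  · by_cases hij : j = i₀
    · subst hij; rw [Pi.single_eq_same, ← C_1, weight_C]; exact hW
    · rw [Pi.single_eq_of_ne hij, weight_zero]; exact Nat.zero_le _
  · exact hM i j

omit [Fintype ι] in
/-- Entries of total degree `≤ D` stay so after replacing a row by a standard basis vector. -/
theorem totalDegree_updateRow_single_le {R : Type*} [CommRing R] (M : Matrix ι ι (MvPolynomial κ R))
    {D : ℕ} (hM : ∀ i j, (M i j).totalDegree ≤ D) (j₀ i₀ i j : ι) :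
    (M.updateRow j₀ (Pi.single i₀ 1) i j).totalDegree ≤ D := by
  rw [Matrix.updateRow_apply]
  split_ifs with h
  · by_cases hij : j = i₀
    · subst hij; rw [Pi.single_eq_same, totalDegree_one]; exact Nat.zero_le _
    · rw [Pi.single_eq_of_ne hij, totalDegree_zero]; exact Nat.zero_le _
  · exact hM i j

/-- **Weight of an adjugate entry.** -/
theorem weight_adjugate_le (M : Matrix ι ι (MvPolynomial κ ℤ)) {W : ℕ} (hW : 1 ≤ W)
    (hM : ∀ i j, weight (M i j) ≤ W) (i j : ι) :
    weight (M.adjugate i j) ≤ (Fintype.card ι).factorial * W ^ Fintype.card ι := by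
  rw [Matrix.adjugate_apply]
  exact weight_det_le _ fun i' j' => weight_updateRow_single_le M hW hM j i i' j'

/-- **Total degree of an adjugate entry.** -/
theorem totalDegree_adjugate_le {R : Type*} [CommRing R] (M : Matrix ι ι (MvPolynomial κ R)) {D : ℕ}
    (hM : ∀ i j, (M i j).totalDegree ≤ D) (i j : ι) :
    (M.adjugate i j).totalDegree ≤ Fintype.card ι * D := by
  rw [Matrix.adjugate_apply]
  exact totalDegree_det_le _ fun i' j' => totalDegree_updateRow_single_le M hM j i i' j'

end Summit.ValiantsHypothesis.ValiantsHypothesis.Theorems.LangWeilTransfer
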